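import Summits.BirchSwinnertonDyer.Rank1Residual.AdditivePotMult.QuadraticTwistTamagawaMultiplicative
import Summits.BirchSwinnertonDyer.Rank1Residual.AdditivePotMult.QuadraticBaseChangeSplitParity
import Literature.NumberTheory.EllipticCurves.QuadraticTwistLocalPolynomialTwoProofs
import Literature.NumberTheory.DiophantineGeometry.TateAlgorithmIstarEvalProofs
import HarnessLib

/-!
# The unit twist `d ≡ 1 (mod 4)` at the multiplicative place `2`: same `n`, splitness flips iff
# `d ≡ 5 (mod 8)` (row T-MIL-ODD, FILE A-2two = skeleton item (M4) at `ℓ = 2`; seat n1011-p01 GEN 6)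

HONEST FRAMING (cell `b2b-bsdres`, run/shared/lean/b2b/bsd-rank1-residual/, verbatim in every
file): the goal of the cell is to DELETE the COMBINATION-SHAPED residual classes of the
Birch–Swinnerton-Dyer formula for ALL analytic-rank `≤ 1` elliptic curves over `ℚ` — "full BSD
formula for every rank `≤ 1` curve in class `C`" assembled STRICTLY from published theorems — so
that the rank-`≤ 1` remainder becomes exactly the CONSTRUCTION-SHAPED classes, which are TYPED
(missing-input `Prop`s), NOT attempted. This is not "finishing BSD". Sub-classes X3♯(M) / X4(M)
(additive, potentially multiplicative prime; base-change-and-descend): a RESEARCH ROUTE; they stay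
CONSTRUCTION-SHAPED; nothing is booked by this file; no mark / label moved. THEOREMS ONLY: no
definition, no named fact, no `sorry`.

## What and why (row T-MIL-ODD, `cells/n1011/skel/T-MIL-ODD.md` §1 (M), item (M4) at `ℓ = 2`)

Stage A-2a (`QuadraticTwistTamagawaMultiplicative`) treated the unit twist at an ODD multiplicative
place. At `ℓ = 2` the twist equation `V.quadraticTwist d` is not `2`-integral; for `d = 1 + 4c`
the tree's `QuadraticTwistLocalPolynomialTwoProofs` supplies the `2`-integral model `X'_c` of the
twist (minimal when `X` is: `isMinimal_baseChange_twistLiftTwo`), of the same reduction type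
(`hasMultiplicativeReduction_twistLiftTwo_iff`), whose node is the Artin–Schreier twist of the node
of `X`: split ↔ non-split are EXCHANGED iff `c̄ ∉ ℘(k) = {z² + z}`
(`hasSplitMultiplicativeReduction_twistLiftTwo_iff`). Over `k = 𝔽₂`, `℘(𝔽₂) = {0}`, so the flip
happens iff `c` is odd, i.e. `d ≡ 5 (mod 8)` — the Kronecker symbol `(d/2) = −1`, `2` INERT in
`ℚ(√d)`. This file reads it in the number-field currency of the row:

* `hasMultiplicativeReductionAt_and_split_iff_quadraticTwist_two` — for `V/ℚ` globally minimal
  multiplicative at the place `v` over `2` and `d ≡ 1 (mod 4)`: `V^{(d)}` is multiplicative at `v`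
  with the same `n = ord_v Δ_min` (`Δ(X'_c) = d⁶Δ(X)`, `d` a `2`-adic unit; tree
  `ordMinimalDiscriminant_eq_of_isMinimal` on the two minimal equations), and
  `V^{(d)}` split ⟺ (`2 ∣ c` ⟺ `V` split);
* `padicValNat_localTamagawaNumber_add_quadraticTwist_two_of_emod_eight_eq_five` — **for
  `d ≡ 5 (mod 8)` and every odd `p`: `v_p(c_v(V)) + v_p(c_v(V^{(d)})) = v_p(n)`** (exactly one of
  the two is split) — the twist side of (L_2)@p at an inert multiplicative `2`, which removes the
  `d_K ≡ 1 (mod 8)` proviso of the END theorem of FILE C-3d at a multiplicative place `2`.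

In print: Kramer, Trans. AMS 264 (1981) §2 Props. 4–5 (`F/ℚ₂` unramified); Silverman *AEC* App. A
Prop. 1.1 (Artin–Schreier form in characteristic 2), Exercise A.2; Comalada 1994 §2. HONEST LIMITS:
TOOL theorems; closes no class; discharges no fact by itself.
-/

noncomputable section

open scoped Classical NumberField

open Polynomial WeierstrassCurve NumberField IsDedekindDomain Rat.HeightOneSpectrum
  Literature.NumberTheory.EllipticCurves Field IsLocalRing
  Summit.BirchSwinnertonDyer.Rank1Residual.Additive

namespace Summit.BirchSwinnertonDyer.Rank1Residual.AdditivePotMult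

/-- Notation (local to this file, copied from `QuadraticTwistLocalPolynomialTwoProofs`) for the
explicit `R`-model `X'_c` of the twist of `X` by `1 + 4c`. -/
local notation3 "𝕋[" R ", " X ", " c "]" =>
  (⟨(WeierstrassCurve.integralModel R X).a₁,
    c * (WeierstrassCurve.integralModel R X).a₁ ^ 2 + (1 + 4 * c) * (WeierstrassCurve.integralModel R X).a₂,
    (1 + 4 * c) * (WeierstrassCurve.integralModel R X).a₃,
    2 * (1 + 4 * c) * c * (WeierstrassCurve.integralModel R X).a₁ * (WeierstrassCurve.integralModel R X).a₃ +
      (1 + 4 * c) ^ 2 * (WeierstrassCurve.integralModel R X).a₄,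
    (1 + 4 * c) ^ 2 * c * (WeierstrassCurve.integralModel R X).a₃ ^ 2 +
      (1 + 4 * c) ^ 3 * (WeierstrassCurve.integralModel R X).a₆⟩ : WeierstrassCurve R)

section Two

variable (v : HeightOneSpectrum (𝓞 ℚ))

/-- `2 = 0` in the residue field `κ(𝒪_v) ≅ 𝔽₂` of the place over `2` (stage A-1a
`charP_residueField_of_mem`). [folklore] -/
theorem residue_two_eq_zero (hv2 : (primesEquiv v : ℕ) = 2) :
    residue (v.adicCompletionIntegers ℚ) 2 = 0 := by
  have hmem : ((2 : ℕ) : 𝓞 ℚ) ∈ v.asIdeal := by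
    rw [natCast_mem_asIdeal_iff_eq_primesEquiv_symm _ Nat.prime_two, Equiv.eq_symm_apply]
    exact Subtype.ext hv2
  haveI := charP_residueField_of_mem 2 v hmem
  have h : ((2 : ℕ) : ResidueField (v.adicCompletionIntegers ℚ)) = 0 := CharP.cast_eq_zero _ 2
  rw [Nat.cast_ofNat] at h
  rw [map_ofNat]
  exact h

/-- **The Artin–Schreier condition over `𝔽₂`**: for an integer `c`, `z² + z = c̄` is soluble in the
residue field `κ(𝒪_v) ≅ ℤ/2` of the place over `2` iff `c` is even (`℘(𝔽₂) = {0}`; transport along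
`ZMod.ringEquivOfPrime`, then `decide`). [cite: SilvermanAEC2009, Appendix A, Prop. 1.1 and Exercise A.2] -/
theorem exists_sq_add_self_eq_residue_intCast_iff (hv2 : (primesEquiv v : ℕ) = 2) (c : ℤ) :
    (∃ z : ResidueField (v.adicCompletionIntegers ℚ),
        z ^ 2 + z = residue (v.adicCompletionIntegers ℚ) (c : v.adicCompletionIntegers ℚ)) ↔
      (2 : ℤ) ∣ c := by
  have hcard : Nat.card (ResidueField (v.adicCompletionIntegers ℚ)) = 2 := by
    rw [WeierstrassCurve.natCard_residueField_adicCompletionIntegers v, hv2]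
  haveI : Finite (ResidueField (v.adicCompletionIntegers ℚ)) :=
    Nat.finite_of_card_ne_zero (by rw [hcard]; norm_num)
  letI : Fintype (ResidueField (v.adicCompletionIntegers ℚ)) := Fintype.ofFinite _
  have hcard' : Fintype.card (ResidueField (v.adicCompletionIntegers ℚ)) = 2 := by
    rw [Fintype.card_eq_nat_card, hcard]
  let e : ZMod 2 ≃+* ResidueField (v.adicCompletionIntegers ℚ) :=
    ZMod.ringEquivOfPrime _ Nat.prime_two hcard'
  have he : e ((c : ℤ) : ZMod 2) = residue (v.adicCompletionIntegers ℚ) (c : v.adicCompletionIntegers ℚ) := by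
    rw [map_intCast, map_intCast]
  have key : ((c : ℤ) : ZMod 2) = 0 ↔ (2 : ℤ) ∣ c := by
    have h := ZMod.intCast_zmod_eq_zero_iff_dvd c 2
    simpa using h
  rw [← he, ← key]
  constructor
  · rintro ⟨z, hz⟩
    have hz' : (e.symm z) ^ 2 + e.symm z = (c : ZMod 2) := by
      apply e.injective
      rw [map_add, map_pow, RingEquiv.apply_symm_apply, hz]
    revert hz'
    generalize e.symm z = t
    generalize (c : ZMod 2) = s
    decide +revert
  · intro hc
    refine ⟨0, ?_⟩
    rw [hc, map_zero]
    ring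

variable (V : WeierstrassCurve ℚ) [V.IsElliptic] [V.IsGloballyMinimal]

/-- **The unit twist `d ≡ 1 (mod 4)` at the multiplicative place over `2`: type, `n`, splitness.**
For `V/ℚ` globally minimal with multiplicative reduction at the place `v` over `2` and `d = 1 + 4c`:
`V^{(d)}` is multiplicative at `v`, `ord_v Δ_min(V^{(d)}) = ord_v Δ_min(V)`, and `V^{(d)}` is split at
`v` iff (`2 ∣ c` ⟺ `V` is split at `v`). The `2`-integral twist model `X'_c` of the tree's
`QuadraticTwistLocalPolynomialTwoProofs` is a MINIMAL equation of `V^{(d)} ⊗ ℚ_2`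
(`isMinimal_baseChange_twistLiftTwo`, `exists_baseChange_twistLiftTwo_eq_smul`), multiplicative with
`X` (`hasMultiplicativeReduction_twistLiftTwo_iff`), with `Δ(X'_c) = d⁶ Δ(X)`
(`Δ_baseChange_twistLiftTwo`; `ordMinimalDiscriminant_eq_of_isMinimal`) and node the Artin–Schreier
twist of the node of `X` (`hasSplitMultiplicativeReduction_twistLiftTwo_iff`; over `𝔽₂` the
condition `c̄ ∈ ℘(k)` is `2 ∣ c`); the chosen local minimal models are compared through
`hasMultiplicativeReduction_iff_of_isMinimal_of_eq_smul` /
`hasSplitMultiplicativeReduction_iff_of_isMinimal_of_eq_smul`. Kramer 1981 §2 Props. 4–5.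
[cite: SilvermanAEC2009, VII.5 Prop. 5.1(b), X.2 Prop. 2.4 and Appendix A Prop. 1.1] -/
theorem hasMultiplicativeReductionAt_and_split_iff_quadraticTwist_two
    (hv2 : (primesEquiv v : ℕ) = 2) {d : ℤ} (hd4 : d % 4 = 1)
    (hmult : V.HasMultiplicativeReductionAt v) :
    (V.quadraticTwist (d : ℚ)).HasMultiplicativeReductionAt v ∧
      ((V.quadraticTwist (d : ℚ)).ordMinimalDiscriminant v = V.ordMinimalDiscriminant v) ∧
      ((V.quadraticTwist (d : ℚ)).HasSplitMultiplicativeReductionAt v ↔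
        ((2 : ℤ) ∣ (d - 1) / 4 ↔ V.HasSplitMultiplicativeReductionAt v)) := by
  -- notation: `R = 𝒪_v`, `L = ℚ_v`, `X = V ⊗ L`, `Y = V^{(d)} ⊗ L`, `T = X'_c ⊗ L`
  obtain ⟨c, hc⟩ : ∃ c : ℤ, d = 1 + 4 * c := ⟨(d - 1) / 4, by omega⟩
  have hcd : (d - 1) / 4 = c := by omega
  rw [hcd]
  have hd0 : (d : ℚ) ≠ 0 := by
    have : d ≠ 0 := by omega
    exact_mod_cast this
  haveI := V.isElliptic_quadraticTwist hd0
  haveI hXell : (V.baseChange (v.adicCompletion ℚ)).IsElliptic := by rw [baseChange]; infer_instance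
  haveI hXmin : (V.baseChange (v.adicCompletion ℚ)).IsMinimal (v.adicCompletionIntegers ℚ) :=
    IsGloballyMinimal.isMinimalAt V v
  haveI hYell : ((V.quadraticTwist (d : ℚ)).baseChange (v.adicCompletion ℚ)).IsElliptic := by
    rw [baseChange]; infer_instance
  have hk : residue (v.adicCompletionIntegers ℚ) 2 = 0 := residue_two_eq_zero v hv2
  haveI : Finite (ResidueField (v.adicCompletionIntegers ℚ)) :=
    finite_residueField_adicCompletionIntegers_rat v
  haveI : NeZero (2 : v.adicCompletion ℚ) := ⟨by
    rw [← map_ofNat (algebraMap ℚ (v.adicCompletion ℚ)) 2]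
    exact (_root_.map_ne_zero _).mpr two_ne_zero⟩
  -- the integral twist model over `𝒪_v` is minimal
  haveI hTmin : IsMinimal (v.adicCompletionIntegers ℚ)
      ((𝕋[v.adicCompletionIntegers ℚ, V.baseChange (v.adicCompletion ℚ),
        (c : v.adicCompletionIntegers ℚ)]).baseChange (v.adicCompletion ℚ)) :=
    isMinimal_baseChange_twistLiftTwo (v.adicCompletionIntegers ℚ) hk (V.baseChange (v.adicCompletion ℚ))
      (c : v.adicCompletionIntegers ℚ)
  -- `T = D • Y`
  have hdK : algebraMap (v.adicCompletionIntegers ℚ) (v.adicCompletion ℚ)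
      (1 + 4 * (c : v.adicCompletionIntegers ℚ)) = algebraMap ℚ (v.adicCompletion ℚ) (d : ℚ) := by
    have h1 : (1 + 4 * (c : v.adicCompletionIntegers ℚ) : v.adicCompletionIntegers ℚ) =
        ((1 + 4 * c : ℤ) : v.adicCompletionIntegers ℚ) := by push_cast; ring
    have h2 : (d : ℚ) = ((1 + 4 * c : ℤ) : ℚ) := by rw [hc]
    rw [h1, map_intCast, h2, map_intCast]
  have hY : (V.baseChange (v.adicCompletion ℚ)).quadraticTwist
      (algebraMap (v.adicCompletionIntegers ℚ) (v.adicCompletion ℚ) (1 + 4 * (c : v.adicCompletionIntegers ℚ))) =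
      (V.quadraticTwist (d : ℚ)).baseChange (v.adicCompletion ℚ) := by
    rw [hdK, baseChange, baseChange, map_quadraticTwist]
  obtain ⟨D, hD⟩ := exists_baseChange_twistLiftTwo_eq_smul (v.adicCompletionIntegers ℚ)
    (V.baseChange (v.adicCompletion ℚ)) (c : v.adicCompletionIntegers ℚ)
  rw [hY] at hD
  have hΔX : (V.baseChange (v.adicCompletion ℚ)).Δ ≠ 0 := (V.baseChange (v.adicCompletion ℚ)).isUnit_Δ.ne_zero
  have hΔY : ((V.quadraticTwist (d : ℚ)).baseChange (v.adicCompletion ℚ)).Δ ≠ 0 :=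
    ((V.quadraticTwist (d : ℚ)).baseChange (v.adicCompletion ℚ)).isUnit_Δ.ne_zero
  have hΔT : ((𝕋[v.adicCompletionIntegers ℚ, V.baseChange (v.adicCompletion ℚ),
      (c : v.adicCompletionIntegers ℚ)]).baseChange (v.adicCompletion ℚ)).Δ ≠ 0 := by
    rw [hD, variableChange_Δ]
    exact mul_ne_zero (pow_ne_zero _ (Units.ne_zero _)) hΔY
  -- the chosen local minimal models are `D₀ • X`, `D' • Y = (D' D⁻¹) • T`
  obtain ⟨D₀, hD₀⟩ : ∃ D₀ : VariableChange (v.adicCompletion ℚ),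
      V.localMinimalModel v = D₀ • V.baseChange (v.adicCompletion ℚ) := ⟨_, rfl⟩
  obtain ⟨D', hD'⟩ : ∃ D' : VariableChange (v.adicCompletion ℚ),
      (V.quadraticTwist (d : ℚ)).localMinimalModel v =
        D' • (V.quadraticTwist (d : ℚ)).baseChange (v.adicCompletion ℚ) := ⟨_, rfl⟩
  have hM' : (V.quadraticTwist (d : ℚ)).localMinimalModel v =
      (D' * D⁻¹) • ((𝕋[v.adicCompletionIntegers ℚ, V.baseChange (v.adicCompletion ℚ),
        (c : v.adicCompletionIntegers ℚ)]).baseChange (v.adicCompletion ℚ)) := by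
    rw [hD', hD, smul_smul, inv_mul_cancel_right]
  haveI : (D₀ • V.baseChange (v.adicCompletion ℚ)).IsMinimal (v.adicCompletionIntegers ℚ) := by
    rw [← hD₀]; exact instIsMinimalLocalMinimalModel v V
  haveI : ((D' * D⁻¹) • ((𝕋[v.adicCompletionIntegers ℚ, V.baseChange (v.adicCompletion ℚ),
      (c : v.adicCompletionIntegers ℚ)]).baseChange (v.adicCompletion ℚ))).IsMinimal
        (v.adicCompletionIntegers ℚ) := by
    rw [← hM']; exact instIsMinimalLocalMinimalModel v (V.quadraticTwist (d : ℚ))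
  -- `X` is multiplicative, hence so is `T`
  have hmultX : (V.baseChange (v.adicCompletion ℚ)).HasMultiplicativeReduction
      (v.adicCompletionIntegers ℚ) := by
    have h := hmult
    unfold HasMultiplicativeReductionAt at h
    rwa [hD₀, hasMultiplicativeReduction_iff_of_isMinimal_of_eq_smul _ rfl hΔX] at h
  have hmultT := (hasMultiplicativeReduction_twistLiftTwo_iff (v.adicCompletionIntegers ℚ)
    (X := V.baseChange (v.adicCompletion ℚ)) (c := (c : v.adicCompletionIntegers ℚ)) hk).mpr hmultX
  refine ⟨?_, ?_, ?_⟩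
  · unfold HasMultiplicativeReductionAt
    rw [hM', hasMultiplicativeReduction_iff_of_isMinimal_of_eq_smul _ rfl hΔT]
    exact hmultT
  · -- both `ord Δ_min` are valuations of `Δ` of the minimal equations `T`, `X`; `Δ(T) = d⁶ Δ(X)`
    rw [ordMinimalDiscriminant_eq_of_isMinimal v (V.quadraticTwist (d : ℚ)) _ D hD hΔT,
      ordMinimalDiscriminant_eq_of_isMinimal v V (V.baseChange (v.adicCompletion ℚ)) 1
        (one_smul _ _).symm hΔX]
    have hint : integralModel (v.adicCompletionIntegers ℚ)
        ((𝕋[v.adicCompletionIntegers ℚ, V.baseChange (v.adicCompletion ℚ),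
          (c : v.adicCompletionIntegers ℚ)]).baseChange (v.adicCompletion ℚ)) =
        𝕋[v.adicCompletionIntegers ℚ, V.baseChange (v.adicCompletion ℚ),
          (c : v.adicCompletionIntegers ℚ)] :=
      integralModel_eq_of_baseChange_eq _ _ rfl
    obtain ⟨u, hu⟩ := isUnit_one_add_four_mul (v.adicCompletionIntegers ℚ) hk
      (c : v.adicCompletionIntegers ℚ)
    have hΔ : (integralModel (v.adicCompletionIntegers ℚ)
        ((𝕋[v.adicCompletionIntegers ℚ, V.baseChange (v.adicCompletion ℚ),
          (c : v.adicCompletionIntegers ℚ)]).baseChange (v.adicCompletion ℚ))).Δ =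
        (1 + 4 * (c : v.adicCompletionIntegers ℚ)) ^ 6 *
          (integralModel (v.adicCompletionIntegers ℚ) (V.baseChange (v.adicCompletion ℚ))).Δ := by
      apply FaithfulSMul.algebraMap_injective (v.adicCompletionIntegers ℚ) (v.adicCompletion ℚ)
      rw [integralModel_Δ_eq, map_mul, map_pow, integralModel_Δ_eq]
      exact Δ_baseChange_twistLiftTwo (v.adicCompletionIntegers ℚ) (V.baseChange (v.adicCompletion ℚ))
        (c : v.adicCompletionIntegers ℚ)
    rw [hΔ, ← hu, IsDiscreteValuationRing.addVal_mul, IsDiscreteValuationRing.addVal_pow,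
      IsDiscreteValuationRing.addVal_eq_zero_of_unit, nsmul_zero, zero_add]
  · unfold HasSplitMultiplicativeReductionAt
    rw [hM', hasSplitMultiplicativeReduction_iff_of_isMinimal_of_eq_smul _ rfl hΔT,
      hasSplitMultiplicativeReduction_twistLiftTwo_iff (v.adicCompletionIntegers ℚ) hk hmultX,
      exists_sq_add_self_eq_residue_intCast_iff v hv2 c, hD₀,
      hasSplitMultiplicativeReduction_iff_of_isMinimal_of_eq_smul _ rfl hΔX]

/-- **The pair identity at an INERT multiplicative `2`: `v_p(c_v(V)) + v_p(c_v(V^{(d)})) = v_p(n)`** for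
`V/ℚ` globally minimal multiplicative at the place over `2`, `d ≡ 5 (mod 8)` (`c = (d−1)/4` odd, so
EXACTLY ONE of `V`, `V^{(d)}` is split at `v`, with the common `n = ord_v Δ_min`; the other has
`c_v ∈ {1, 2}`), any odd prime `p` — the `ℓ = 2` companion of A-2a's
`padicValNat_localTamagawaNumber_add_quadraticTwist_of_not_isSquare`.
[cite: SilvermanATAEC1994, IV.9.4 Step 2 and Cor. IV.9.2(d)] -/
theorem padicValNat_localTamagawaNumber_add_quadraticTwist_two_of_emod_eight_eq_five
    (hv2 : (primesEquiv v : ℕ) = 2) {d : ℤ} (hd8 : d % 8 = 5)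
    (hmult : V.HasMultiplicativeReductionAt v) (p : ℕ) [hp : Fact p.Prime] (hodd : p ≠ 2) :
    padicValNat p ((V.baseChange (v.adicCompletion ℚ)).localTamagawaNumber
        (v.adicCompletionIntegers ℚ)) +
      padicValNat p (((V.quadraticTwist (d : ℚ)).baseChange (v.adicCompletion ℚ)).localTamagawaNumber
        (v.adicCompletionIntegers ℚ)) =
      padicValNat p (V.ordMinimalDiscriminant v) := by
  have hd0 : (d : ℚ) ≠ 0 := by
    have : d ≠ 0 := by omega
    exact_mod_cast this
  haveI := V.isElliptic_quadraticTwist hd0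
  have hd4 : d % 4 = 1 := by omega
  have hc2 : ¬ (2 : ℤ) ∣ (d - 1) / 4 := by omega
  obtain ⟨hmultd, hn, hsplit⟩ :=
    hasMultiplicativeReductionAt_and_split_iff_quadraticTwist_two v V hv2 hd4 hmult
  rw [padicValNat_localTamagawaNumber_of_hasMultiplicativeReductionAt v V p hodd hmult,
    padicValNat_localTamagawaNumber_of_hasMultiplicativeReductionAt v (V.quadraticTwist (d : ℚ)) p
      hodd hmultd, hn]
  by_cases hs : V.HasSplitMultiplicativeReductionAt v
  · have hsd : ¬ (V.quadraticTwist (d : ℚ)).HasSplitMultiplicativeReductionAt v := by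
      rw [hsplit]; exact fun h => hc2 (h.mpr hs)
    simp [hs, hsd]
  · have hsd : (V.quadraticTwist (d : ℚ)).HasSplitMultiplicativeReductionAt v := by
      rw [hsplit]; exact ⟨fun h => absurd h hc2, fun h => absurd h hs⟩
    simp [hs, hsd]

end Two

end Summit.BirchSwinnertonDyer.Rank1Residual.AdditivePotMult

end
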